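import Literature.NumberTheory.LFunctions.ZetaScrewGrowthMomentsProofs
import Literature.NumberTheory.LFunctions.ZetaZeroPowerSums
import Literature.NumberTheory.LFunctions.GeneralizedRH
import Literature.NumberTheory.Sieve.HoheiselPrimesShortIntervals
import Mathlib.Analysis.SpecialFunctions.Trigonometric.DerivHyp
import Mathlib.Analysis.Calculus.MeanValue
import Mathlib.Analysis.Complex.RealDeriv
import HarnessLib

/-!
# The zero-side window-rise law for the screw function `Ψ = zetaScrew`, and the rung
`PowerSparseDetect` from it

CELL rh-split, seat rh-split-screw-bridge GEN 10 (family SCREW, lens BRIDGE). LABEL: RH-FREE — every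
declaration in this file is a theorem proved here (no named fact, no `sorry`, no new definition);
RH / quasi-RH appear only as HYPOTHESES or inside EQUIVALENCES. HONEST LABEL: «SPLITTING SEARCH over
kernel-typed RH-EQUIVALENCES; a splitting A ∧ B ⟹ RH is CONDITIONAL bookkeeping unless A and B are both
proved; nothing here bears on the truth of RH.»

## What is proved

Write `Ψ = zetaScrew`, `κ_ρ = ρ − 1/2`, `m(ρ)` the multiplicity, and STRIP(η) for
"`|Re ρ − 1/2| ≤ η` for every non-trivial zero `ρ`" (STRIP(η) ⟺ `QuasiRiemannHypothesis (1/2 + η)`,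
§3; STRIP(1/2) is a theorem; STRIP(0) is RH).

1. **Window-rise law (W).** STRIP(η) ⟹ `|Ψ(t) − Ψ(t₀)| ≤ B e^{ηt} √(t − t₀)` for all `0 ≤ t₀ ≤ t`,
   with the explicit constant `B = √2 · Σ_ρ m(ρ)/|ρ − 1/2|^{3/2}` (`abs_sub_le_of_strip`,
   `windowRise_of_strip`). Proof: the unconditional zero series
   `Ψ(x) = Σ_ρ m(ρ)(cosh(κ_ρ x) − 1)/κ_ρ²` (Suzuki 2023 Thm 1.1 (2), tree
   `Suzuki2023_thm11_series_holds`); termwise `|cosh(κt) − cosh(κt₀)| ≤ e^{ηt} min(2, |κ|(t − t₀))`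
   (crude bound + mean value theorem on `s ↦ cosh(κs)`), `min(2, a) ≤ √(2a)`, and the power sum
   `Σ_ρ m(ρ)/|ρ − 1/2|^{3/2} < ∞` (tree `ZetaZeroSum.summable_zeroOrder_div_norm_sub_half_rpow`,
   Montgomery–Vaughan Thm 10.13). Unconditionally (η = 1/2): `|Ψ(t) − Ψ(t₀)| ≤ B e^{t/2} √(t − t₀)`
   (`windowRise`); under `QuasiRiemannHypothesis (1/2 + η)` with exponent `η` (`windowRise_of_quasiRH`);
   under RH, `Ψ` is uniformly ½-Hölder on `[0, ∞)` (`sqrtHolder_of_RH`).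
2. **The rung `PowerSparseDetect` from S1 + (W) + S3** (`powerSparseDetect_of`): the registered line
   `Cruxes/ScrewPolyFloor/Lines/PowerSparseDetect.lean` composes the rung
   `∀ θ < 1, ∀ C, ∀ (C,θ)-dense A ⊆ ℕ, (∀ a ∈ A, Ψ(log a) ≥ 0) → RH` from S1 `stub_omegaDepth`
   (Ω-depth), S2 `stub_riseBound` (PRIME-SIDE one-sided Lipschitz rise, size L, open) and S3
   `stub_denseHits`. Here S2 is BYPASSED: the ZERO-SIDE law (W) at `η = Θ − 1/2`, `Θ` = the supremum
   of the real parts of the zeros (a strip by the reflection `ρ ↦ 1 − ρ`, no hypothesis), keeps a deep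
   negative value `Ψ(t₀) < −K e^{(η−δ')t₀}` negative on the window `[t₀, t₀ + e^{−δt₀}]`
   (`√(e^{−δt₀}) = e^{−δt₀/2}` and `δ' ≤ δ/2`), where S3 puts a node `log a`, `a ∈ A`. So
   `powerSparseDetect_of : S1 → S3 → PowerSparseDetect` (stated with S1, S3 unfolded VERBATIM as the
   line's `Sig.stub_omegaDepth`, `Sig.stub_denseHits`, and the conclusion unfolded verbatim as
   `Theses.SparseScrew.PowerSparseDetect`; both S1 and S3 are proved in the g9 files
   `Splittings/ScrewGradedFloor*.lean`, `Splittings/ScrewSparseDetect.lean` of this cell, so with them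
   the rung is a THEOREM — see the cell's `ConcatG10.lean`).
3. **RH ⟺ `Ψ` uniformly ½-Hölder on `[0,∞)`**, modulo S1 (`rh_iff_sqrtHolder_of`): ⟹ is (W) at
   `η = 0`; ⟸: a Hölder modulus gives the floor `Ψ(t) ≥ −B√t`, incompatible with the Ω-depth
   `Ψ(t) < −K e^{ηt}` that S1 extracts from an off-line zero.

What is NOT here: the prime-side Lipschitz bound S2 itself (Ingham Thm 30 / von Koch with `Θ` for
`1/2`; not needed any more for the rung), and any claim about the truth of RH or of S4
`stub_sparseDiagonal` (RH-strength by design).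

References: M. Suzuki, *Aspects of the screw function corresponding to the Riemann zeta-function*,
J. Lond. Math. Soc. 108 (2023) = arXiv:2206.03682, Thm 1.1 (2), Thm 1.7 [Suzuki2023];
H. L. Montgomery, R. C. Vaughan, *Multiplicative Number Theory I* (2007), Thm 10.13, Thm 15.3
[MontgomeryVaughan2007].

## CARVE NOTE (rh-split-typer-2 g5, lead RULING #102 (b′), 2026-08-27)

This is PART A (§§1–3: the `cosh` two-point estimate, the window-rise law (W) from the zero series, and its
unconditional / quasi-RH / RH instances) of the frozen object `HOME/rh-split-screw-bridge/g10/ScrewWindowRise.lean`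
(sha16 233eb18714544943, 697 lines; author seat rh-split-screw-bridge g10; referee rh-split-ref-2 g2 REPLAY + NEGCTL +
STUB-CHECK + LABELS PASS 2026-08-27T12:28:52Z), carved at the declaration boundary before §4 because tree files are
≤ 400 lines.  Lines 74–332 of the source are reproduced BYTE-IDENTICALLY below, except that four one-line `[folklore]`
docstrings were ADDED in front of the private helpers `norm_cosh_le`, `norm_sinh_le`, `abs_re_mul_le`, `hasDerivAt_cosh_mul`
(gate `lint.docstring` at the 13:24Z dry-run) and that `strip_of_quasiRH_half_add` (used only inside this file) carries the ONE
extra word `private` (gate `dedup.landed` at the 13:32Z dry-run: its statement restates the landed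
`…Splittings.ScrewGradedFloor.strip_of_quasiRH` of `ScrewGradedFloorDictionary.lean`; RULING #51/#85-class repair, declared in
CUT.md v3; no other byte touched); the module docstring above is the source's, verbatim; PART B (`Splittings/ScrewWindowRiseB.lean`, §§4–6: the rung `PowerSparseDetect` from S1 + (W) + S3,
RH ⟺ ½-Hölder, the two sparse node sets) imports this file and re-opens the same namespace, so every declaration keeps
its refereed fully-qualified name `…Theorems.Splittings.ScrewWindowRise.<decl>`.  No statement, proof or docstring byte
of any declaration was changed.  Nothing here bears on the truth of RH.
-/

set_option linter.dupNamespace false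

noncomputable section

open Complex Filter Set

namespace Summit.RiemannHypothesis.RiemannHypothesis.Theorems.Splittings.ScrewWindowRise

open Literature.NumberTheory.LFunctions
open ZetaZeros.riemannZetaNontrivialZeros

/-! ## 1. Two values of `cosh` on a segment: `|cosh(κt) − cosh(κt₀)| ≤ e^{ηt} √(2|κ|(t − t₀))` -/

/-- Crude bound `‖cosh w‖ ≤ e^{|Re w|}` (from `‖e^{±w}‖ = e^{±Re w}`). [folklore] -/
private theorem norm_cosh_le (w : ℂ) : ‖Complex.cosh w‖ ≤ Real.exp |w.re| := by
  have h : Complex.cosh w = (Complex.exp w + Complex.exp (-w)) / 2 := rfl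
  rw [h, norm_div, RCLike.norm_two]
  have h1 : ‖Complex.exp w‖ ≤ Real.exp |w.re| := by
    rw [Complex.norm_exp]
    exact Real.exp_le_exp.2 (le_abs_self _)
  have h2 : ‖Complex.exp (-w)‖ ≤ Real.exp |w.re| := by
    rw [Complex.norm_exp, neg_re]
    exact Real.exp_le_exp.2 (neg_le_abs _)
  have h3 : ‖Complex.exp w + Complex.exp (-w)‖ ≤ ‖Complex.exp w‖ + ‖Complex.exp (-w)‖ :=
    norm_add_le _ _
  linarith

/-- Crude bound `‖sinh w‖ ≤ e^{|Re w|}`. [folklore] -/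
private theorem norm_sinh_le (w : ℂ) : ‖Complex.sinh w‖ ≤ Real.exp |w.re| := by
  have h : Complex.sinh w = (Complex.exp w - Complex.exp (-w)) / 2 := rfl
  rw [h, norm_div, RCLike.norm_two]
  have h1 : ‖Complex.exp w‖ ≤ Real.exp |w.re| := by
    rw [Complex.norm_exp]
    exact Real.exp_le_exp.2 (le_abs_self _)
  have h2 : ‖Complex.exp (-w)‖ ≤ Real.exp |w.re| := by
    rw [Complex.norm_exp, neg_re]
    exact Real.exp_le_exp.2 (neg_le_abs _)
  have h3 : ‖Complex.exp w - Complex.exp (-w)‖ ≤ ‖Complex.exp w‖ + ‖Complex.exp (-w)‖ :=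
    norm_sub_le _ _
  linarith

/-- `|Re(κs)| ≤ ηt` for `|Re κ| ≤ η` and `0 ≤ s ≤ t`. [folklore] -/
private theorem abs_re_mul_le {κ : ℂ} {η s t : ℝ} (hκ : |κ.re| ≤ η) (hs : 0 ≤ s) (hst : s ≤ t) :
    |(κ * (s : ℂ)).re| ≤ η * t := by
  have hη : 0 ≤ η := (abs_nonneg _).trans hκ
  have hre : (κ * (s : ℂ)).re = κ.re * s := by simp [Complex.mul_re]
  rw [hre, abs_mul, abs_of_nonneg hs]
  exact mul_le_mul hκ hst hs hη

/-- `d/dx cosh(κx) = sinh(κx)·κ` along the real variable `x`. [folklore] -/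
private theorem hasDerivAt_cosh_mul (κ : ℂ) (s : ℝ) :
    HasDerivAt (fun x : ℝ ↦ Complex.cosh (κ * (x : ℂ))) (Complex.sinh (κ * (s : ℂ)) * κ) s := by
  have h1 : HasDerivAt (fun w : ℂ ↦ κ * w) κ (s : ℂ) := by
    simpa using (hasDerivAt_id (s : ℂ)).const_mul κ
  exact h1.ccosh.comp_ofReal

/-- `min(2, a) ≤ √(2a)` in the form used below: `D ≤ 2E` and `D ≤ aE` give `D ≤ E√(2a)`. -/
private theorem le_mul_sqrt_of_le_of_le {D E a : ℝ} (hD : 0 ≤ D) (hE : 0 ≤ E)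
    (hA : D ≤ 2 * E) (hB : D ≤ a * E) : D ≤ E * Real.sqrt (2 * a) := by
  have hsq : D ^ 2 ≤ E ^ 2 * (2 * a) := by
    have h := mul_le_mul hA hB hD (mul_nonneg zero_le_two hE)
    calc D ^ 2 = D * D := sq D
      _ ≤ 2 * E * (a * E) := h
      _ = E ^ 2 * (2 * a) := by ring
  calc D ≤ Real.sqrt (E ^ 2 * (2 * a)) := Real.le_sqrt_of_sq_le hsq
    _ = E * Real.sqrt (2 * a) := by rw [Real.sqrt_mul (sq_nonneg E), Real.sqrt_sq hE]

/-- **(W1)** Two values of `cosh(κ·)` on `[t₀, t] ⊆ [0, ∞)` under `|Re κ| ≤ η`: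
`|cosh(κt) − cosh(κt₀)| ≤ e^{ηt} √(2|κ|(t − t₀))` (crude bound `2e^{ηt}` and the mean value bound
`|κ| e^{ηt} (t − t₀)`, combined by `min(2,a) ≤ √(2a)`). -/
theorem norm_cosh_sub_cosh_le {κ : ℂ} {η t₀ t : ℝ} (hκ : |κ.re| ≤ η) (ht₀ : 0 ≤ t₀)
    (ht : t₀ ≤ t) :
    ‖Complex.cosh (κ * (t : ℂ)) - Complex.cosh (κ * (t₀ : ℂ))‖ ≤
      Real.exp (η * t) * Real.sqrt (2 * (‖κ‖ * (t - t₀))) := by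
  have hE0 : 0 < Real.exp (η * t) := Real.exp_pos _
  have hcosh : ∀ s : ℝ, 0 ≤ s → s ≤ t → ‖Complex.cosh (κ * (s : ℂ))‖ ≤ Real.exp (η * t) :=
    fun s hs hst ↦ (norm_cosh_le _).trans (Real.exp_le_exp.2 (abs_re_mul_le hκ hs hst))
  -- (a) crude
  have hA : ‖Complex.cosh (κ * (t : ℂ)) - Complex.cosh (κ * (t₀ : ℂ))‖ ≤ 2 * Real.exp (η * t) := by
    calc ‖Complex.cosh (κ * (t : ℂ)) - Complex.cosh (κ * (t₀ : ℂ))‖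
        ≤ ‖Complex.cosh (κ * (t : ℂ))‖ + ‖Complex.cosh (κ * (t₀ : ℂ))‖ := norm_sub_le _ _
      _ ≤ Real.exp (η * t) + Real.exp (η * t) :=
          add_le_add (hcosh t (ht₀.trans ht) le_rfl) (hcosh t₀ ht₀ ht)
      _ = 2 * Real.exp (η * t) := by ring
  -- (b) mean value theorem on `s ↦ cosh(κ s)`
  have hB : ‖Complex.cosh (κ * (t : ℂ)) - Complex.cosh (κ * (t₀ : ℂ))‖ ≤
      ‖κ‖ * (t - t₀) * Real.exp (η * t) := by
    have hf : ∀ x ∈ Icc t₀ t, HasDerivWithinAt (fun x : ℝ ↦ Complex.cosh (κ * (x : ℂ)))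
        (Complex.sinh (κ * (x : ℂ)) * κ) (Icc t₀ t) x :=
      fun x _ ↦ (hasDerivAt_cosh_mul κ x).hasDerivWithinAt
    have hbound : ∀ x ∈ Ico t₀ t, ‖Complex.sinh (κ * (x : ℂ)) * κ‖ ≤ ‖κ‖ * Real.exp (η * t) := by
      intro x hx
      have hx0 : 0 ≤ x := ht₀.trans hx.1
      rw [norm_mul]
      calc ‖Complex.sinh (κ * (x : ℂ))‖ * ‖κ‖ ≤ Real.exp (η * t) * ‖κ‖ :=
            mul_le_mul_of_nonneg_right
              ((norm_sinh_le _).trans (Real.exp_le_exp.2 (abs_re_mul_le hκ hx0 hx.2.le)))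
              (norm_nonneg _)
        _ = ‖κ‖ * Real.exp (η * t) := mul_comm _ _
    have hmvt := norm_image_sub_le_of_norm_deriv_le_segment' hf hbound t (right_mem_Icc.2 ht)
    calc ‖Complex.cosh (κ * (t : ℂ)) - Complex.cosh (κ * (t₀ : ℂ))‖
        ≤ ‖κ‖ * Real.exp (η * t) * (t - t₀) := hmvt
      _ = ‖κ‖ * (t - t₀) * Real.exp (η * t) := by ring
  exact le_mul_sqrt_of_le_of_le (norm_nonneg _) hE0.le hA hB

/-! ## 2. The window-rise law from the zero series -/

/-- **(W2)** Termwise bound in `Ψ(t) − Ψ(t₀) = Σ_ρ m(ρ)(cosh(κ_ρ t) − cosh(κ_ρ t₀))/κ_ρ²` under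
STRIP(η): `≤ √2 e^{ηt} √(t − t₀) · m(ρ)/|ρ − 1/2|^{3/2}`. -/
theorem norm_term_sub_le {η : ℝ}
    (hstrip : ∀ ρ : ℂ, ρ ∈ ZetaZeros.riemannZetaNontrivialZeros → |ρ.re - 1 / 2| ≤ η)
    (ρ : ZetaZeros.riemannZetaNontrivialZeros) {t₀ t : ℝ} (ht₀ : 0 ≤ t₀) (ht : t₀ ≤ t) :
    ‖(riemannZetaZeroOrder (ρ : ℂ) : ℂ) *
          ((Complex.cosh (((ρ : ℂ) - 1 / 2) * t) - 1) / ((ρ : ℂ) - 1 / 2) ^ 2) -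
        (riemannZetaZeroOrder (ρ : ℂ) : ℂ) *
          ((Complex.cosh (((ρ : ℂ) - 1 / 2) * t₀) - 1) / ((ρ : ℂ) - 1 / 2) ^ 2)‖ ≤
      (Real.sqrt 2 * Real.exp (η * t) * Real.sqrt (t - t₀)) *
        ((riemannZetaZeroOrder (ρ : ℂ) : ℝ) / ‖(ρ : ℂ) - 1 / 2‖ ^ (3 / 2 : ℝ)) := by
  have hm := FordL33.order_pos ρ
  have hκre : (((ρ : ℂ) - 1 / 2).re) = (ρ : ℂ).re - 1 / 2 := by simp
  have hκ : |((ρ : ℂ) - 1 / 2).re| ≤ η := by rw [hκre]; exact hstrip (ρ : ℂ) ρ.2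
  have hκ0 : (ρ : ℂ) - 1 / 2 ≠ 0 := by
    intro h
    have him := im_ne_zero ρ.2
    have : ((ρ : ℂ) - 1 / 2).im = 0 := by rw [h]; simp
    simp at this
    exact him this
  have hn : 0 < ‖(ρ : ℂ) - 1 / 2‖ := norm_pos_iff.2 hκ0
  have hsn : 0 < Real.sqrt ‖(ρ : ℂ) - 1 / 2‖ := Real.sqrt_pos.2 hn
  have hn32 : 0 < ‖(ρ : ℂ) - 1 / 2‖ ^ (3 / 2 : ℝ) := Real.rpow_pos_of_pos hn _
  have hdiff : (riemannZetaZeroOrder (ρ : ℂ) : ℂ) *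
          ((Complex.cosh (((ρ : ℂ) - 1 / 2) * t) - 1) / ((ρ : ℂ) - 1 / 2) ^ 2) -
        (riemannZetaZeroOrder (ρ : ℂ) : ℂ) *
          ((Complex.cosh (((ρ : ℂ) - 1 / 2) * t₀) - 1) / ((ρ : ℂ) - 1 / 2) ^ 2) =
      (riemannZetaZeroOrder (ρ : ℂ) : ℂ) *
        ((Complex.cosh (((ρ : ℂ) - 1 / 2) * t) - Complex.cosh (((ρ : ℂ) - 1 / 2) * t₀)) /
          ((ρ : ℂ) - 1 / 2) ^ 2) := by ring
  rw [hdiff, norm_mul, norm_div, norm_pow, Complex.norm_intCast, abs_of_pos hm]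
  -- the `cosh` difference
  have hD := norm_cosh_sub_cosh_le (κ := (ρ : ℂ) - 1 / 2) hκ ht₀ ht
  have hsqrt : Real.sqrt (2 * (‖(ρ : ℂ) - 1 / 2‖ * (t - t₀))) =
      Real.sqrt 2 * (Real.sqrt ‖(ρ : ℂ) - 1 / 2‖ * Real.sqrt (t - t₀)) := by
    rw [Real.sqrt_mul (by norm_num : (0 : ℝ) ≤ 2), Real.sqrt_mul (norm_nonneg _)]
  rw [hsqrt] at hD
  -- `|κ|² = |κ|^{3/2} √|κ|`
  have hpow : ‖(ρ : ℂ) - 1 / 2‖ ^ 2 = ‖(ρ : ℂ) - 1 / 2‖ ^ (3 / 2 : ℝ) * Real.sqrt ‖(ρ : ℂ) - 1 / 2‖ := by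
    rw [Real.sqrt_eq_rpow, ← Real.rpow_add hn, show (3 / 2 : ℝ) + 1 / 2 = 2 by norm_num,
      Real.rpow_two]
  have hfrac : ‖Complex.cosh (((ρ : ℂ) - 1 / 2) * t) - Complex.cosh (((ρ : ℂ) - 1 / 2) * t₀)‖ /
        ‖(ρ : ℂ) - 1 / 2‖ ^ 2 ≤
      Real.sqrt 2 * Real.exp (η * t) * Real.sqrt (t - t₀) / ‖(ρ : ℂ) - 1 / 2‖ ^ (3 / 2 : ℝ) := by
    have h1 := div_le_div_of_nonneg_right hD (sq_nonneg ‖(ρ : ℂ) - 1 / 2‖)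
    refine h1.trans (le_of_eq ?_)
    rw [hpow, div_eq_div_iff (mul_ne_zero hn32.ne' hsn.ne') hn32.ne']
    ring
  calc (riemannZetaZeroOrder (ρ : ℂ) : ℝ) *
        (‖Complex.cosh (((ρ : ℂ) - 1 / 2) * t) - Complex.cosh (((ρ : ℂ) - 1 / 2) * t₀)‖ /
          ‖(ρ : ℂ) - 1 / 2‖ ^ 2)
      ≤ (riemannZetaZeroOrder (ρ : ℂ) : ℝ) *
          (Real.sqrt 2 * Real.exp (η * t) * Real.sqrt (t - t₀) / ‖(ρ : ℂ) - 1 / 2‖ ^ (3 / 2 : ℝ)) :=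
        mul_le_mul_of_nonneg_left hfrac hm.le
    _ = (Real.sqrt 2 * Real.exp (η * t) * Real.sqrt (t - t₀)) *
          ((riemannZetaZeroOrder (ρ : ℂ) : ℝ) / ‖(ρ : ℂ) - 1 / 2‖ ^ (3 / 2 : ℝ)) := by ring

/-- **(W3) THE WINDOW-RISE LAW WITH ITS CONSTANT.** Under STRIP(η), for `0 ≤ t₀ ≤ t`:
`|Ψ(t) − Ψ(t₀)| ≤ √2 e^{ηt} √(t − t₀) · Σ_ρ m(ρ)/|ρ − 1/2|^{3/2}`. -/
theorem abs_sub_le_of_strip {η : ℝ}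
    (hstrip : ∀ ρ : ℂ, ρ ∈ ZetaZeros.riemannZetaNontrivialZeros → |ρ.re - 1 / 2| ≤ η)
    {t₀ t : ℝ} (ht₀ : 0 ≤ t₀) (ht : t₀ ≤ t) :
    |zetaScrew t - zetaScrew t₀| ≤ (Real.sqrt 2 * Real.exp (η * t) * Real.sqrt (t - t₀)) *
      ∑' ρ : ZetaZeros.riemannZetaNontrivialZeros,
        (riemannZetaZeroOrder (ρ : ℂ) : ℝ) / ‖(ρ : ℂ) - 1 / 2‖ ^ (3 / 2 : ℝ) := by
  have hsum := (Suzuki2023_thm11_series_holds t).sub (Suzuki2023_thm11_series_holds t₀)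
  have hS : HasSum (fun ρ : ZetaZeros.riemannZetaNontrivialZeros ↦
      (Real.sqrt 2 * Real.exp (η * t) * Real.sqrt (t - t₀)) *
        ((riemannZetaZeroOrder (ρ : ℂ) : ℝ) / ‖(ρ : ℂ) - 1 / 2‖ ^ (3 / 2 : ℝ)))
      ((Real.sqrt 2 * Real.exp (η * t) * Real.sqrt (t - t₀)) *
        ∑' ρ : ZetaZeros.riemannZetaNontrivialZeros,
          (riemannZetaZeroOrder (ρ : ℂ) : ℝ) / ‖(ρ : ℂ) - 1 / 2‖ ^ (3 / 2 : ℝ)) :=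
    (ZetaZeroSum.summable_zeroOrder_div_norm_sub_half_rpow
      (by norm_num : (1 : ℝ) < 3 / 2)).hasSum.mul_left
      (Real.sqrt 2 * Real.exp (η * t) * Real.sqrt (t - t₀))
  have h := tsum_of_norm_bounded hS (fun ρ ↦ norm_term_sub_le hstrip ρ ht₀ ht)
  rw [hsum.tsum_eq, ← Complex.ofReal_sub, Complex.norm_real, Real.norm_eq_abs] at h
  exact h

/-- The constant `Σ_ρ m(ρ)/|ρ − 1/2|^{3/2}` is `≥ 0`. -/
theorem tsum_threeHalves_nonneg :
    0 ≤ ∑' ρ : ZetaZeros.riemannZetaNontrivialZeros,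
      (riemannZetaZeroOrder (ρ : ℂ) : ℝ) / ‖(ρ : ℂ) - 1 / 2‖ ^ (3 / 2 : ℝ) :=
  tsum_nonneg fun ρ ↦ div_nonneg (FordL33.order_pos ρ).le (Real.rpow_nonneg (norm_nonneg _) _)

/-- **(W) THE WINDOW-RISE LAW.** If every non-trivial zero satisfies `|Re ρ − 1/2| ≤ η`, then
`|Ψ(t) − Ψ(t₀)| ≤ B e^{ηt} √(t − t₀)` for all `0 ≤ t₀ ≤ t`, for some `B ≥ 0`. -/
theorem windowRise_of_strip {η : ℝ}
    (hstrip : ∀ ρ : ℂ, ρ ∈ ZetaZeros.riemannZetaNontrivialZeros → |ρ.re - 1 / 2| ≤ η) :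
    ∃ B : ℝ, 0 ≤ B ∧ ∀ t₀ t : ℝ, 0 ≤ t₀ → t₀ ≤ t →
      |zetaScrew t - zetaScrew t₀| ≤ B * Real.exp (η * t) * Real.sqrt (t - t₀) := by
  refine ⟨Real.sqrt 2 * ∑' ρ : ZetaZeros.riemannZetaNontrivialZeros,
      (riemannZetaZeroOrder (ρ : ℂ) : ℝ) / ‖(ρ : ℂ) - 1 / 2‖ ^ (3 / 2 : ℝ),
    mul_nonneg (Real.sqrt_nonneg 2) tsum_threeHalves_nonneg, fun t₀ t ht₀ ht ↦ ?_⟩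
  calc |zetaScrew t - zetaScrew t₀|
      ≤ (Real.sqrt 2 * Real.exp (η * t) * Real.sqrt (t - t₀)) *
          ∑' ρ : ZetaZeros.riemannZetaNontrivialZeros,
            (riemannZetaZeroOrder (ρ : ℂ) : ℝ) / ‖(ρ : ℂ) - 1 / 2‖ ^ (3 / 2 : ℝ) :=
        abs_sub_le_of_strip hstrip ht₀ ht
    _ = Real.sqrt 2 * (∑' ρ : ZetaZeros.riemannZetaNontrivialZeros,
            (riemannZetaZeroOrder (ρ : ℂ) : ℝ) / ‖(ρ : ℂ) - 1 / 2‖ ^ (3 / 2 : ℝ)) *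
          Real.exp (η * t) * Real.sqrt (t - t₀) := by ring

/-! ## 3. Instances: unconditional (η = 1/2), quasi-RH (η), RH (η = 0) -/

/-- STRIP(1/2) is a theorem: the non-trivial zeros lie in `0 < Re ρ < 1`. -/
theorem strip_half : ∀ ρ : ℂ, ρ ∈ ZetaZeros.riemannZetaNontrivialZeros → |ρ.re - 1 / 2| ≤ 1 / 2 := by
  intro ρ hρ
  have h0 := re_pos hρ
  have h1 := re_lt_one hρ
  rw [abs_le]
  constructor <;> linarith

/-- **(W½) UNCONDITIONAL window-rise law:** `|Ψ(t) − Ψ(t₀)| ≤ B e^{t/2} √(t − t₀)`, `0 ≤ t₀ ≤ t`. -/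
theorem windowRise : ∃ B : ℝ, 0 ≤ B ∧ ∀ t₀ t : ℝ, 0 ≤ t₀ → t₀ ≤ t →
    |zetaScrew t - zetaScrew t₀| ≤ B * Real.exp (t / 2) * Real.sqrt (t - t₀) := by
  obtain ⟨B, hB0, hB⟩ := windowRise_of_strip strip_half
  refine ⟨B, hB0, fun t₀ t ht₀ ht ↦ ?_⟩
  rw [show t / 2 = 1 / 2 * t by ring]
  exact hB t₀ t ht₀ ht

/-- `QuasiRiemannHypothesis (1/2 + η)` is STRIP(η) (reflection `ρ ↦ 1 − ρ`,
`GeneralizedRH.riemannZeta_one_sub_eq_zero`). -/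
private theorem strip_of_quasiRH_half_add {η : ℝ} (hq : QuasiRiemannHypothesis (1 / 2 + η)) :
    ∀ ρ : ℂ, ρ ∈ ZetaZeros.riemannZetaNontrivialZeros → |ρ.re - 1 / 2| ≤ η := by
  intro ρ hρ
  have hζ := zeta_eq_zero hρ
  have h0 := re_pos hρ
  have h1 := re_lt_one hρ
  rw [abs_le]
  constructor
  · by_contra h
    have h' := not_le.1 h
    refine hq (1 - ρ) (GeneralizedRH.riemannZeta_one_sub_eq_zero hζ h0 h1) ?_ ?_
    · simp only [sub_re, one_re]; linarith
    · simp only [sub_re, one_re]; linarith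
  · by_contra h
    have h' := not_le.1 h
    exact hq ρ hζ (by linarith) h1

/-- Conversely STRIP(η), `η ≥ 0`, gives `QuasiRiemannHypothesis (1/2 + η)`. -/
theorem quasiRH_half_add_of_strip {η : ℝ} (hη : 0 ≤ η)
    (hstrip : ∀ ρ : ℂ, ρ ∈ ZetaZeros.riemannZetaNontrivialZeros → |ρ.re - 1 / 2| ≤ η) :
    QuasiRiemannHypothesis (1 / 2 + η) := by
  intro s hs h1 h2
  have hmem : s ∈ ZetaZeros.riemannZetaNontrivialZeros := mem_of_re_pos hs (by linarith)
  have := (abs_le.1 (hstrip s hmem)).2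
  linarith

/-- **(Wq) BRIDGE ROW:** `QuasiRiemannHypothesis (1/2 + η)` ⟹ the window-rise law with exponent `η`. -/
theorem windowRise_of_quasiRH {η : ℝ} (hq : QuasiRiemannHypothesis (1 / 2 + η)) :
    ∃ B : ℝ, 0 ≤ B ∧ ∀ t₀ t : ℝ, 0 ≤ t₀ → t₀ ≤ t →
      |zetaScrew t - zetaScrew t₀| ≤ B * Real.exp (η * t) * Real.sqrt (t - t₀) :=
  windowRise_of_strip (strip_of_quasiRH_half_add hq)

/-- **(W0) RH ⟹ `Ψ` is uniformly ½-Hölder on `[0, ∞)`:** `|Ψ(t) − Ψ(t₀)| ≤ B √(t − t₀)`. -/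
theorem sqrtHolder_of_RH (hRH : _root_.RiemannHypothesis) :
    ∃ B : ℝ, 0 ≤ B ∧ ∀ t₀ t : ℝ, 0 ≤ t₀ → t₀ ≤ t →
      |zetaScrew t - zetaScrew t₀| ≤ B * Real.sqrt (t - t₀) := by
  have hq : QuasiRiemannHypothesis (1 / 2 + 0) := by
    rw [add_zero]
    exact quasiRiemannHypothesis_one_half_iff_holds.2 hRH
  obtain ⟨B, hB0, hB⟩ := windowRise_of_strip (strip_of_quasiRH_half_add hq)
  refine ⟨B, hB0, fun t₀ t ht₀ ht ↦ ?_⟩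
  have h := hB t₀ t ht₀ ht
  rwa [zero_mul, Real.exp_zero, mul_one] at h


end Summit.RiemannHypothesis.RiemannHypothesis.Theorems.Splittings.ScrewWindowRise

end
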